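import Mathlib
import HarnessLib
import Summits.AtomisticToContinuum.Crystallization.Theses.GscTwinLoopSurgery
import Literature.MathematicalPhysics.StatisticalMechanics.LocalLimitOfGroundStates
import Literature.MathematicalPhysics.StatisticalMechanics.HardCoreGSC

/-!
# Birth skeleton (BC3) for crux `GscTwinLoopSurgery.TwinLoopLemma`
(item `stmt-AtomisticToContinuum-14084`, route `route-AtomisticToContinuum-GscTwinLoopSurgery`,
sub-problem `Crystallization`; registrar `planner-skel-stmt-AtomisticToContinuum-14084-0`, 2026-08-17)

Crux (FIXED, concluded BY NAME below): for `(a,h) ∈ B′ = {191/200 ≤ a ≤ 197/200, (81/100)a ≤ h ≤ (329/400)a}`,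
a Hägg word `s`, Hägg domination at `(a,h)` (`Σ k|J_k| < ∞`, `J₂ < 0`, `Σ_{k≥3}(k−1)|J_k| ≤ |J₂|/2`,
`J_k = barlowCoupling lennardJones a h k`) and `X ∈ 𝔏` (local limit of translated LJ ground states) a
hard-core GSC GLOBALLY two-way `(1/1000)`-matched with `P := barlowStacking a h s`:
the wall set `{m | s (m+1) = s m}` is `Set.Subsingleton` (at most one twin wall).

## Line `birth` — Shockley-loop surgery = (regularity: low-strain windows) + (energetics: wall-pair surgery)

If the wall set has two elements, pick a CONSECUTIVE pair of walls `m₁ < m₂` (no wall strictly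
between; proved below, `exists_next_wall`), of gap `D = m₂ − m₁`.  The crux is cut along the two
genuinely different inputs named in its `why it might fail`:

* `stub_lowStrainWindows` (REGULARITY / Liouville-type flatness of a GSC near a layered reference; L–XL):
  a uniformly discrete hard-core GSC `X` globally `(1/1000)`-close to `P` is, at EVERY prescribed height
  `z₀`, for every tolerance `ε > 0` and radius `L`, two-way `ε`-matched on SOME ball `B(c, L)` with
  `c₂ = z₀` with a LAYERWISE-TRANSLATED copy of `P` (`⋃ₖ (barlowLayer a h s k + v k)`, `‖v k‖ ≤ 1/500`):
  the displacement `X − P` is, window-wise, constant on each layer (per-layer translations absorb the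
  intrinsic interlayer relaxation at walls, which is why a single translate would be false).  Content:
  Caccioppoli (GSC surgery bounds the excess energy of `B_L` by `O(L²)`), harmonic stability of Barlow
  stackings on `B′`, averaging over the `(L'/L)²` lateral translates inside the slab at height `z₀`, and
  local regularity (mean-square strain `O(1/L)` ⇒ sup-norm flatness on a concentric ball).  The `hcp`
  case (`s = alternatingHagg`, any height) is essentially the sister crux `HcpPerfectWindows` (14085).
* `stub_evenGapSurgery` (ENERGETICS, the mechanism for EVEN gap `D`; L): for `X` uniformly discrete,
  globally `(1/1000)`-close to `P` and `ε`-flat (in the above layerwise sense) on a large ball centred at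
  the mid-height of a consecutive wall pair of even gap, there is a STRICTLY profitable finite
  rearrangement `y ↦ z` of `X` (in the exact `IsHardCoreGSC` format of the crux).  Competitor: the
  coherent block flip `s ↦ −s` on `(m₁, m₂]` restricted to a disc of radius `L` — alternate layers of the
  block slide rigidly by `∓2w` (`w = barlowOffset a`), registry-preserving above the block because the
  window sum of the even alternating stretch vanishes; gain `≥ (|J₂| − Σ_{k≥3}(k−1)|J_k|)·2` per column
  (`≥ |J₂|` by domination; the two walls become non-walls, `≤ 2(k−1)` range-`k` pairs change), i.e.
  `≥ c·L²`; cost: rim pairs at distance `≥ |w|` (`O(D·L)`), `r⁻⁶` truncation tails (`O(L)`), and the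
  strain cross terms, which are `O(ε·D·L²) + O(1e−7·L²)` thanks to `ε`-flatness and the three-fold
  symmetry of every layer (first-order terms are `−Σ F·u`; if `X` is not force-balanced on the window a
  plain local relaxation is already strictly profitable — the stub only asserts EXISTENCE).  NO net
  Burgers vector, no elastic far field.
* `stub_oddGapSurgery` (ENERGETICS for ODD gap `D`; XL, the hardest): same conclusion; here no
  compactly supported registry-preserving word surgery exists (window sum `±1`), so the competitor is the
  block flip PLUS one Shockley-partial glide loop of radius `L` with net Burgers vector `w` (Volterra
  displacement field, truncated far away): gain `≥ c·L²` against line energy `O(L log L)`, core `O(L)`,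
  cross terms `O(ε·|w|·L²)` — hence the need for `ε ≪ |J₂|/(V″|w|) ≈ 4e−5`, far below the crux's
  `1e−3`, which is exactly what `stub_lowStrainWindows` supplies.  Rigorous lattice upper bounds for
  Volterra loop fields: HudsonOrtner2014, EhrlacherOrtnerShapeev2016, AyalaChoksiWirth2025 (cited on the
  crux); template: Dobrushin1973 (two Ising walls removed by a cylinder flip); loop physics CaiNix2016 §11.1.
* COMPOSITION `TwinLoopLemma_of` (kernel-checked, sorry-free outside the stubs): crux hypotheses ⇒
  `UniformlyDiscrete X` (PROVED Literature lemma
  `IsLocalLimitOfGroundStates.uniformlyDiscrete_lennardJones` + `LennardJonesMinimalDistance_holds`);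
  two distinct walls ⇒ a consecutive pair (`exists_next_wall`, `Nat.find`); parity of the gap selects the
  surgery stub, which returns `(ε, L)`; the regularity stub places the `ε`-flat window at the pair's
  mid-height; the surgery stub returns a strictly profitable `(y, z)`; the crux's hard-core-GSC hypothesis
  says `≤` — contradiction.  `twinLoopLemma_of_stubs` instantiates it with the three `stub_*` (this also
  certifies that the readable `def`s below are LITERALLY the registered inlined signatures).

Hardest stub: `stub_oddGapSurgery` (elastic loop with net Burgers vector on a lattice, uniform in `D`).
Why the cut is not a costume: no stub carries the crux's hypothesis set — the two surgery stubs have NO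
ground-state / GSC / provenance hypothesis (they are statements about explicit configurations near an
explicit two-walled stacking; `X = P` itself satisfies their hypotheses, so they assert in particular that
the IDEAL two-walled stacking is finitely improvable), and the regularity stub concludes a window
statement, not a wall count; `stub → TwinLoopLemma` and `stub → Crystallization` by
`first | exact? | simpa | aesop` FAIL for all three (planner folder `bc/`, quoted in NOTES.md).
Typing checklist 4c: no Bochner integrals; all `tsum`s are over uniformly discrete sets with the `r⁻⁶`
tail (absolutely convergent, `UniformlyDiscrete.summable_lennardJones_dist`); thresholds are the crux's
own (`1/1000`, box `B′`) plus the slack `1/500 = 1/1000 + room for ε`; `ε`, `L` are existential.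
Disproof used: none on file (`ledger crux ls stmt-AtomisticToContinuum-14084`: no workfiles, 2026-08-17);
refuter crux-attack (2026-08-15) evidence respected: the conclusion depends on `s` only and is FALSE for
`fccStacking` without the `X`-hypotheses — here every stub that concludes about energies keeps the global
matching AND uses the walls of `s` explicitly; `X = ∅` is excluded by the global matching (P ≠ ∅).
Fallback recorded by the route (KILL CRITERIA (v)): if `stub_oddGapSurgery` resists uniformly in `D`, the
planner restates the crux as `WallFreeStretches`; the even stub alone already yields "no two consecutive
walls at even gap".
-/

noncomputable section

open scoped BigOperators

namespace Summit.AtomisticToContinuum.Crystallization.Cruxes.TwinLoopLemma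

namespace Birth

/-! ## Readable names for the three stub statements (each DEFINITIONALLY the inlined stub text;
`twinLoopLemma_of_stubs` below type-checks only because they agree verbatim) -/

/-- Statement of `stub_lowStrainWindows`: layerwise-flat windows of a hard-core GSC near a Barlow
stacking, at every height, tolerance and radius. -/
def LowStrainWindows : Prop :=
  ∀ (a h : ℝ) (s : ℤ → ℤ) (X : Set (EuclideanSpace ℝ (Fin 3))),
    (191 / 200 ≤ a ∧ a ≤ 197 / 200 ∧ 81 / 100 * a ≤ h ∧ h ≤ 329 / 400 * a) →
    Literature.MathematicalPhysics.StatisticalMechanics.IsHaggSeq s →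
    Literature.MathematicalPhysics.StatisticalMechanics.UniformlyDiscrete X →
    Literature.MathematicalPhysics.StatisticalMechanics.IsHardCoreGSC
      Literature.MathematicalPhysics.StatisticalMechanics.lennardJones X →
    ((∀ p ∈ Literature.MathematicalPhysics.StatisticalMechanics.barlowStacking a h s,
        ∃ q ∈ X, dist q p ≤ 1 / 1000) ∧
      (∀ q ∈ X, ∃ p ∈ Literature.MathematicalPhysics.StatisticalMechanics.barlowStacking a h s,
        dist q p ≤ 1 / 1000)) →
    ∀ (ε L z₀ : ℝ), 0 < ε →
      ∃ (c : EuclideanSpace ℝ (Fin 3)) (v : ℤ → EuclideanSpace ℝ (Fin 3)),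
        c 2 = z₀ ∧ (∀ k : ℤ, ‖v k‖ ≤ 1 / 500) ∧
        Literature.MathematicalPhysics.StatisticalMechanics.BallMatch ε L c X
          (⋃ k : ℤ, (fun p => p + v k) ''
            Literature.MathematicalPhysics.StatisticalMechanics.barlowLayer a h s k)

/-- Statement of `stub_evenGapSurgery`: a consecutive wall pair of EVEN gap in the reference word makes
every uniformly discrete, globally `(1/1000)`-close, window-wise `ε`-flat configuration finitely
improvable (strictly), for some `ε > 0` and window radius `L` depending only on the data. -/
def EvenGapSurgery : Prop :=
  ∀ (a h : ℝ) (s : ℤ → ℤ) (X : Set (EuclideanSpace ℝ (Fin 3))) (m₁ m₂ : ℤ),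
    (191 / 200 ≤ a ∧ a ≤ 197 / 200 ∧ 81 / 100 * a ≤ h ∧ h ≤ 329 / 400 * a) →
    Literature.MathematicalPhysics.StatisticalMechanics.IsHaggSeq s →
    (Summable (fun k : ℕ => (k : ℝ) *
        |Literature.MathematicalPhysics.StatisticalMechanics.barlowCoupling
          Literature.MathematicalPhysics.StatisticalMechanics.lennardJones a h k|) ∧
      Literature.MathematicalPhysics.StatisticalMechanics.barlowCoupling
          Literature.MathematicalPhysics.StatisticalMechanics.lennardJones a h 2 < 0 ∧
      ∑' k : ℕ, (if 3 ≤ k then ((k : ℝ) - 1) *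
          |Literature.MathematicalPhysics.StatisticalMechanics.barlowCoupling
            Literature.MathematicalPhysics.StatisticalMechanics.lennardJones a h k| else 0) ≤
        (1 / 2) * |Literature.MathematicalPhysics.StatisticalMechanics.barlowCoupling
          Literature.MathematicalPhysics.StatisticalMechanics.lennardJones a h 2|) →
    Literature.MathematicalPhysics.StatisticalMechanics.UniformlyDiscrete X →
    ((∀ p ∈ Literature.MathematicalPhysics.StatisticalMechanics.barlowStacking a h s,
        ∃ q ∈ X, dist q p ≤ 1 / 1000) ∧
      (∀ q ∈ X, ∃ p ∈ Literature.MathematicalPhysics.StatisticalMechanics.barlowStacking a h s,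
        dist q p ≤ 1 / 1000)) →
    m₁ < m₂ → s (m₁ + 1) = s m₁ → s (m₂ + 1) = s m₂ →
    (∀ m : ℤ, m₁ < m → m < m₂ → s (m + 1) ≠ s m) →
    Even (m₂ - m₁) →
    ∃ ε : ℝ, 0 < ε ∧ ∃ L : ℝ,
      ∀ (c : EuclideanSpace ℝ (Fin 3)) (v : ℤ → EuclideanSpace ℝ (Fin 3)),
        c 2 = ((m₁ : ℝ) + m₂) * h / 2 → (∀ k : ℤ, ‖v k‖ ≤ 1 / 500) →
        Literature.MathematicalPhysics.StatisticalMechanics.BallMatch ε L c X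
          (⋃ k : ℤ, (fun p => p + v k) ''
            Literature.MathematicalPhysics.StatisticalMechanics.barlowLayer a h s k) →
        ∃ (n : ℕ) (y z : Fin n → EuclideanSpace ℝ (Fin 3)),
          Function.Injective y ∧ Function.Injective z ∧ Set.range y ⊆ X ∧
          Disjoint (Set.range z) (X \ Set.range y) ∧
          Literature.MathematicalPhysics.StatisticalMechanics.interactionEnergy
                Literature.MathematicalPhysics.StatisticalMechanics.lennardJones z +
              ∑ i, ∑' q : ↥(X \ Set.range y),
                Literature.MathematicalPhysics.StatisticalMechanics.lennardJones
                  (dist (z i) (q : EuclideanSpace ℝ (Fin 3))) <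
            Literature.MathematicalPhysics.StatisticalMechanics.interactionEnergy
                Literature.MathematicalPhysics.StatisticalMechanics.lennardJones y +
              ∑ i, ∑' q : ↥(X \ Set.range y),
                Literature.MathematicalPhysics.StatisticalMechanics.lennardJones
                  (dist (y i) (q : EuclideanSpace ℝ (Fin 3)))

/-- Statement of `stub_oddGapSurgery`: the same for a consecutive wall pair of ODD gap (the competitor
needs a glide loop with net partial Burgers vector). -/
def OddGapSurgery : Prop :=
  ∀ (a h : ℝ) (s : ℤ → ℤ) (X : Set (EuclideanSpace ℝ (Fin 3))) (m₁ m₂ : ℤ),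
    (191 / 200 ≤ a ∧ a ≤ 197 / 200 ∧ 81 / 100 * a ≤ h ∧ h ≤ 329 / 400 * a) →
    Literature.MathematicalPhysics.StatisticalMechanics.IsHaggSeq s →
    (Summable (fun k : ℕ => (k : ℝ) *
        |Literature.MathematicalPhysics.StatisticalMechanics.barlowCoupling
          Literature.MathematicalPhysics.StatisticalMechanics.lennardJones a h k|) ∧
      Literature.MathematicalPhysics.StatisticalMechanics.barlowCoupling
          Literature.MathematicalPhysics.StatisticalMechanics.lennardJones a h 2 < 0 ∧
      ∑' k : ℕ, (if 3 ≤ k then ((k : ℝ) - 1) *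
          |Literature.MathematicalPhysics.StatisticalMechanics.barlowCoupling
            Literature.MathematicalPhysics.StatisticalMechanics.lennardJones a h k| else 0) ≤
        (1 / 2) * |Literature.MathematicalPhysics.StatisticalMechanics.barlowCoupling
          Literature.MathematicalPhysics.StatisticalMechanics.lennardJones a h 2|) →
    Literature.MathematicalPhysics.StatisticalMechanics.UniformlyDiscrete X →
    ((∀ p ∈ Literature.MathematicalPhysics.StatisticalMechanics.barlowStacking a h s,
        ∃ q ∈ X, dist q p ≤ 1 / 1000) ∧
      (∀ q ∈ X, ∃ p ∈ Literature.MathematicalPhysics.StatisticalMechanics.barlowStacking a h s,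
        dist q p ≤ 1 / 1000)) →
    m₁ < m₂ → s (m₁ + 1) = s m₁ → s (m₂ + 1) = s m₂ →
    (∀ m : ℤ, m₁ < m → m < m₂ → s (m + 1) ≠ s m) →
    Odd (m₂ - m₁) →
    ∃ ε : ℝ, 0 < ε ∧ ∃ L : ℝ,
      ∀ (c : EuclideanSpace ℝ (Fin 3)) (v : ℤ → EuclideanSpace ℝ (Fin 3)),
        c 2 = ((m₁ : ℝ) + m₂) * h / 2 → (∀ k : ℤ, ‖v k‖ ≤ 1 / 500) →
        Literature.MathematicalPhysics.StatisticalMechanics.BallMatch ε L c X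
          (⋃ k : ℤ, (fun p => p + v k) ''
            Literature.MathematicalPhysics.StatisticalMechanics.barlowLayer a h s k) →
        ∃ (n : ℕ) (y z : Fin n → EuclideanSpace ℝ (Fin 3)),
          Function.Injective y ∧ Function.Injective z ∧ Set.range y ⊆ X ∧
          Disjoint (Set.range z) (X \ Set.range y) ∧
          Literature.MathematicalPhysics.StatisticalMechanics.interactionEnergy
                Literature.MathematicalPhysics.StatisticalMechanics.lennardJones z +
              ∑ i, ∑' q : ↥(X \ Set.range y),
                Literature.MathematicalPhysics.StatisticalMechanics.lennardJones
                  (dist (z i) (q : EuclideanSpace ℝ (Fin 3))) <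
            Literature.MathematicalPhysics.StatisticalMechanics.interactionEnergy
                Literature.MathematicalPhysics.StatisticalMechanics.lennardJones y +
              ∑ i, ∑' q : ↥(X \ Set.range y),
                Literature.MathematicalPhysics.StatisticalMechanics.lennardJones
                  (dist (y i) (q : EuclideanSpace ℝ (Fin 3)))

/-! ## The three registered stubs (signatures fully inlined and fully qualified) -/

/-- **stub 1 — `stub_lowStrainWindows` (regularity; L–XL).**  For `(a,h) ∈ B′`, a Hägg word `s`,
and a uniformly discrete hard-core Lennard-Jones GSC `X` globally two-way `(1/1000)`-matched with
`barlowStacking a h s`: for every `ε > 0`, every radius `L` and every height `z₀` there are a centre `c`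
with `c₂ = z₀` and per-layer translations `v k` (`‖v k‖ ≤ 1/500`) such that `X` and the layerwise
translated stacking `⋃ₖ (barlowLayer a h s k + v k)` are two-way `ε`-matched on the ball `B(c, L)`
(`BallMatch ε L c X _`).  Caccioppoli from the GSC surgery bound + harmonic stability of Barlow
stackings on `B′` + lateral averaging in the slab + local regularity; per-layer translations absorb the
intrinsic wall relaxation.  Open; false only if a bounded (`≤ 1e−3`) equilibrium displacement field on
a layered close packing can keep strain bounded below on every large window of a slab. -/
theorem stub_lowStrainWindows :
    ∀ (a h : ℝ) (s : ℤ → ℤ) (X : Set (EuclideanSpace ℝ (Fin 3))),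
      (191 / 200 ≤ a ∧ a ≤ 197 / 200 ∧ 81 / 100 * a ≤ h ∧ h ≤ 329 / 400 * a) →
      Literature.MathematicalPhysics.StatisticalMechanics.IsHaggSeq s →
      Literature.MathematicalPhysics.StatisticalMechanics.UniformlyDiscrete X →
      Literature.MathematicalPhysics.StatisticalMechanics.IsHardCoreGSC
        Literature.MathematicalPhysics.StatisticalMechanics.lennardJones X →
      ((∀ p ∈ Literature.MathematicalPhysics.StatisticalMechanics.barlowStacking a h s,
          ∃ q ∈ X, dist q p ≤ 1 / 1000) ∧
        (∀ q ∈ X, ∃ p ∈ Literature.MathematicalPhysics.StatisticalMechanics.barlowStacking a h s,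
          dist q p ≤ 1 / 1000)) →
      ∀ (ε L z₀ : ℝ), 0 < ε →
        ∃ (c : EuclideanSpace ℝ (Fin 3)) (v : ℤ → EuclideanSpace ℝ (Fin 3)),
          c 2 = z₀ ∧ (∀ k : ℤ, ‖v k‖ ≤ 1 / 500) ∧
          Literature.MathematicalPhysics.StatisticalMechanics.BallMatch ε L c X
            (⋃ k : ℤ, (fun p => p + v k) ''
              Literature.MathematicalPhysics.StatisticalMechanics.barlowLayer a h s k) := by
  sorry

/-- **stub 2 — `stub_evenGapSurgery` (energetics, even gap; L).**  For `(a,h) ∈ B′`, a Hägg word `s`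
with Hägg domination at `(a,h)` and a CONSECUTIVE wall pair `m₁ < m₂` (`s (mᵢ+1) = s mᵢ`, no wall
strictly between) of EVEN gap, and any uniformly discrete `X` globally two-way `(1/1000)`-matched with
`barlowStacking a h s`: there are `ε > 0` and `L` such that whenever `X` is two-way `ε`-matched on the
ball of radius `L` about a centre at height `(m₁+m₂)h/2` with a layerwise translated copy of the
stacking (`‖v k‖ ≤ 1/500`), some finite rearrangement `y ↦ z` (`y`, `z` injective, `range y ⊆ X`,
`range z` disjoint from `X ∖ range y`) STRICTLY lowers `interactionEnergy + field` — the coherent block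
flip of `(m₁, m₂]` in a disc (alternate layers slide by `∓2·barlowOffset a`; gain `≥ |J₂|` per column by
domination, rim `O(D·L)`, tails `O(L)`, strain cross terms `O(ε·D·L²)`; or a plain local relaxation if
`X` is not force-balanced on the window).  No GSC hypothesis: in particular the ideal two-walled
stacking itself is finitely improvable. -/
theorem stub_evenGapSurgery :
    ∀ (a h : ℝ) (s : ℤ → ℤ) (X : Set (EuclideanSpace ℝ (Fin 3))) (m₁ m₂ : ℤ),
      (191 / 200 ≤ a ∧ a ≤ 197 / 200 ∧ 81 / 100 * a ≤ h ∧ h ≤ 329 / 400 * a) →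
      Literature.MathematicalPhysics.StatisticalMechanics.IsHaggSeq s →
      (Summable (fun k : ℕ => (k : ℝ) *
          |Literature.MathematicalPhysics.StatisticalMechanics.barlowCoupling
            Literature.MathematicalPhysics.StatisticalMechanics.lennardJones a h k|) ∧
        Literature.MathematicalPhysics.StatisticalMechanics.barlowCoupling
            Literature.MathematicalPhysics.StatisticalMechanics.lennardJones a h 2 < 0 ∧
        ∑' k : ℕ, (if 3 ≤ k then ((k : ℝ) - 1) *
            |Literature.MathematicalPhysics.StatisticalMechanics.barlowCoupling
              Literature.MathematicalPhysics.StatisticalMechanics.lennardJones a h k| else 0) ≤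
          (1 / 2) * |Literature.MathematicalPhysics.StatisticalMechanics.barlowCoupling
            Literature.MathematicalPhysics.StatisticalMechanics.lennardJones a h 2|) →
      Literature.MathematicalPhysics.StatisticalMechanics.UniformlyDiscrete X →
      ((∀ p ∈ Literature.MathematicalPhysics.StatisticalMechanics.barlowStacking a h s,
          ∃ q ∈ X, dist q p ≤ 1 / 1000) ∧
        (∀ q ∈ X, ∃ p ∈ Literature.MathematicalPhysics.StatisticalMechanics.barlowStacking a h s,
          dist q p ≤ 1 / 1000)) →
      m₁ < m₂ → s (m₁ + 1) = s m₁ → s (m₂ + 1) = s m₂ →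
      (∀ m : ℤ, m₁ < m → m < m₂ → s (m + 1) ≠ s m) →
      Even (m₂ - m₁) →
      ∃ ε : ℝ, 0 < ε ∧ ∃ L : ℝ,
        ∀ (c : EuclideanSpace ℝ (Fin 3)) (v : ℤ → EuclideanSpace ℝ (Fin 3)),
          c 2 = ((m₁ : ℝ) + m₂) * h / 2 → (∀ k : ℤ, ‖v k‖ ≤ 1 / 500) →
          Literature.MathematicalPhysics.StatisticalMechanics.BallMatch ε L c X
            (⋃ k : ℤ, (fun p => p + v k) ''
              Literature.MathematicalPhysics.StatisticalMechanics.barlowLayer a h s k) →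
          ∃ (n : ℕ) (y z : Fin n → EuclideanSpace ℝ (Fin 3)),
            Function.Injective y ∧ Function.Injective z ∧ Set.range y ⊆ X ∧
            Disjoint (Set.range z) (X \ Set.range y) ∧
            Literature.MathematicalPhysics.StatisticalMechanics.interactionEnergy
                  Literature.MathematicalPhysics.StatisticalMechanics.lennardJones z +
                ∑ i, ∑' q : ↥(X \ Set.range y),
                  Literature.MathematicalPhysics.StatisticalMechanics.lennardJones
                    (dist (z i) (q : EuclideanSpace ℝ (Fin 3))) <
              Literature.MathematicalPhysics.StatisticalMechanics.interactionEnergy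
                  Literature.MathematicalPhysics.StatisticalMechanics.lennardJones y +
                ∑ i, ∑' q : ↥(X \ Set.range y),
                  Literature.MathematicalPhysics.StatisticalMechanics.lennardJones
                    (dist (y i) (q : EuclideanSpace ℝ (Fin 3))) := by
  sorry

/-- **stub 3 — `stub_oddGapSurgery` (energetics, odd gap; XL, the hardest).**  As stub 2 for a
consecutive wall pair of ODD gap: no compactly supported registry-preserving word surgery exists (the
window sum of the odd alternating stretch is `±1`), so the profitable competitor is the block flip plus
ONE Shockley-partial glide loop of radius `L` with net Burgers vector `barlowOffset a` (truncated
Volterra field): gain `≥ c·L²` (domination) against line energy `O(L log L)`, core `O(L)` and strain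
cross terms `O(ε·|w|·L²)` — profitable once `ε ≪ |J₂|/(V″|w|)` and `L` is large; or a plain local
relaxation if `X` is not force-balanced on the window.  Rigorous lattice upper bounds for loop fields in
the style of HudsonOrtner2014 / EhrlacherOrtnerShapeev2016 / AyalaChoksiWirth2025. -/
theorem stub_oddGapSurgery :
    ∀ (a h : ℝ) (s : ℤ → ℤ) (X : Set (EuclideanSpace ℝ (Fin 3))) (m₁ m₂ : ℤ),
      (191 / 200 ≤ a ∧ a ≤ 197 / 200 ∧ 81 / 100 * a ≤ h ∧ h ≤ 329 / 400 * a) →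
      Literature.MathematicalPhysics.StatisticalMechanics.IsHaggSeq s →
      (Summable (fun k : ℕ => (k : ℝ) *
          |Literature.MathematicalPhysics.StatisticalMechanics.barlowCoupling
            Literature.MathematicalPhysics.StatisticalMechanics.lennardJones a h k|) ∧
        Literature.MathematicalPhysics.StatisticalMechanics.barlowCoupling
            Literature.MathematicalPhysics.StatisticalMechanics.lennardJones a h 2 < 0 ∧
        ∑' k : ℕ, (if 3 ≤ k then ((k : ℝ) - 1) *
            |Literature.MathematicalPhysics.StatisticalMechanics.barlowCoupling
              Literature.MathematicalPhysics.StatisticalMechanics.lennardJones a h k| else 0) ≤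
          (1 / 2) * |Literature.MathematicalPhysics.StatisticalMechanics.barlowCoupling
            Literature.MathematicalPhysics.StatisticalMechanics.lennardJones a h 2|) →
      Literature.MathematicalPhysics.StatisticalMechanics.UniformlyDiscrete X →
      ((∀ p ∈ Literature.MathematicalPhysics.StatisticalMechanics.barlowStacking a h s,
          ∃ q ∈ X, dist q p ≤ 1 / 1000) ∧
        (∀ q ∈ X, ∃ p ∈ Literature.MathematicalPhysics.StatisticalMechanics.barlowStacking a h s,
          dist q p ≤ 1 / 1000)) →
      m₁ < m₂ → s (m₁ + 1) = s m₁ → s (m₂ + 1) = s m₂ →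
      (∀ m : ℤ, m₁ < m → m < m₂ → s (m + 1) ≠ s m) →
      Odd (m₂ - m₁) →
      ∃ ε : ℝ, 0 < ε ∧ ∃ L : ℝ,
        ∀ (c : EuclideanSpace ℝ (Fin 3)) (v : ℤ → EuclideanSpace ℝ (Fin 3)),
          c 2 = ((m₁ : ℝ) + m₂) * h / 2 → (∀ k : ℤ, ‖v k‖ ≤ 1 / 500) →
          Literature.MathematicalPhysics.StatisticalMechanics.BallMatch ε L c X
            (⋃ k : ℤ, (fun p => p + v k) ''
              Literature.MathematicalPhysics.StatisticalMechanics.barlowLayer a h s k) →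
          ∃ (n : ℕ) (y z : Fin n → EuclideanSpace ℝ (Fin 3)),
            Function.Injective y ∧ Function.Injective z ∧ Set.range y ⊆ X ∧
            Disjoint (Set.range z) (X \ Set.range y) ∧
            Literature.MathematicalPhysics.StatisticalMechanics.interactionEnergy
                  Literature.MathematicalPhysics.StatisticalMechanics.lennardJones z +
                ∑ i, ∑' q : ↥(X \ Set.range y),
                  Literature.MathematicalPhysics.StatisticalMechanics.lennardJones
                    (dist (z i) (q : EuclideanSpace ℝ (Fin 3))) <
              Literature.MathematicalPhysics.StatisticalMechanics.interactionEnergy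
                  Literature.MathematicalPhysics.StatisticalMechanics.lennardJones y +
                ∑ i, ∑' q : ↥(X \ Set.range y),
                  Literature.MathematicalPhysics.StatisticalMechanics.lennardJones
                    (dist (y i) (q : EuclideanSpace ℝ (Fin 3))) := by
  sorry

/-! ## Proved glue: consecutive walls, and the composition -/

/-- Above any integer `w₁` lying below a wall `w₂` of `s` there is a LEAST wall `m₂ > w₁`: no wall
strictly between `w₁` and `m₂`. [folklore] -/
theorem exists_next_wall {s : ℤ → ℤ} {w₁ w₂ : ℤ} (h₂ : s (w₂ + 1) = s w₂) (hlt : w₁ < w₂) :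
    ∃ m₂ : ℤ, w₁ < m₂ ∧ s (m₂ + 1) = s m₂ ∧ ∀ m : ℤ, w₁ < m → m < m₂ → s (m + 1) ≠ s m := by
  classical
  have hex : ∃ k : ℕ, s (w₁ + 1 + (k : ℤ) + 1) = s (w₁ + 1 + (k : ℤ)) := by
    refine ⟨(w₂ - w₁ - 1).toNat, ?_⟩
    have hk : ((w₂ - w₁ - 1).toNat : ℤ) = w₂ - w₁ - 1 := Int.toNat_of_nonneg (by omega)
    have hw : w₁ + 1 + ((w₂ - w₁ - 1).toNat : ℤ) = w₂ := by omega
    rw [hw]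
    exact h₂
  refine ⟨w₁ + 1 + (Nat.find hex : ℤ), by omega, Nat.find_spec hex, ?_⟩
  intro m hm₁ hm₂ heq
  have hk : ((m - w₁ - 1).toNat : ℤ) = m - w₁ - 1 := Int.toNat_of_nonneg (by omega)
  have hlt' : (m - w₁ - 1).toNat < Nat.find hex := by
    have : ((m - w₁ - 1).toNat : ℤ) < (Nat.find hex : ℤ) := by omega
    exact_mod_cast this
  refine Nat.find_min hex hlt' ?_
  have hm : w₁ + 1 + ((m - w₁ - 1).toNat : ℤ) = m := by omega
  rw [hm]
  exact heq

/-- Two distinct walls give a CONSECUTIVE pair `m₁ < m₂`. [folklore] -/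
theorem exists_consecutive_walls {s : ℤ → ℤ} {w₁ w₂ : ℤ} (h₁ : s (w₁ + 1) = s w₁)
    (h₂ : s (w₂ + 1) = s w₂) (hne : w₁ ≠ w₂) :
    ∃ m₁ m₂ : ℤ, m₁ < m₂ ∧ s (m₁ + 1) = s m₁ ∧ s (m₂ + 1) = s m₂ ∧
      ∀ m : ℤ, m₁ < m → m < m₂ → s (m + 1) ≠ s m := by
  rcases lt_or_gt_of_ne hne with hlt | hlt
  · obtain ⟨m₂, hm, hw, hc⟩ := exists_next_wall h₂ hlt
    exact ⟨w₁, m₂, hm, h₁, hw, hc⟩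
  · obtain ⟨m₂, hm, hw, hc⟩ := exists_next_wall h₁ hlt
    exact ⟨w₂, m₂, hm, h₂, hw, hc⟩

section Composition

open Literature.MathematicalPhysics.StatisticalMechanics

/-- **Skeleton theorem — the crux `GscTwinLoopSurgery.TwinLoopLemma` BY NAME from the three stub
statements.**  Crux hypotheses ⇒ `X` uniformly discrete (Literature, proved:
`IsLocalLimitOfGroundStates.uniformlyDiscrete_lennardJones`, `LennardJonesMinimalDistance_holds`);
two distinct walls ⇒ a consecutive pair; by parity the surgery statement returns `(ε, L)`; the
regularity statement places the `ε`-flat window at the pair's mid-height; the surgery returns a strictly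
profitable finite rearrangement, contradicting the hard-core GSC inequality of the crux. -/
theorem TwinLoopLemma_of (hR : LowStrainWindows) (hE : EvenGapSurgery) (hO : OddGapSurgery) :
    Summit.AtomisticToContinuum.Crystallization.Theses.GscTwinLoopSurgery.TwinLoopLemma := by
  intro a h s X hab hs hdom hlim hgsc hglob
  -- provenance ⇒ hard core (proved Literature facts)
  have hX : IsLocalLimitOfGroundStates lennardJones 3 X := hlim
  have hud : UniformlyDiscrete X :=
    hX.uniformlyDiscrete_lennardJones LennardJonesMinimalDistance_holds
  have hgsc' : IsHardCoreGSC lennardJones X := hgsc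
  -- two walls?
  intro w₁ hw₁ w₂ hw₂
  by_contra hne
  obtain ⟨m₁, m₂, hlt, hwall₁, hwall₂, hcons⟩ := exists_consecutive_walls hw₁ hw₂ hne
  rcases Int.even_or_odd (m₂ - m₁) with hev | hodd
  · -- even gap: coherent block flip
    obtain ⟨ε, hε, L, hS⟩ :=
      hE a h s X m₁ m₂ hab hs hdom hud hglob hlt hwall₁ hwall₂ hcons hev
    obtain ⟨c, v, hc, hv, hmatch⟩ :=
      hR a h s X hab hs hud hgsc' hglob ε L (((m₁ : ℝ) + m₂) * h / 2) hε
    obtain ⟨n, y, z, hy, hz, hyX, hdisj, hlt'⟩ := hS c v hc hv hmatch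
    exact absurd (hgsc' n y z hy hz hyX hdisj) (not_le.mpr hlt')
  · -- odd gap: block flip + glide loop with net Burgers vector
    obtain ⟨ε, hε, L, hS⟩ :=
      hO a h s X m₁ m₂ hab hs hdom hud hglob hlt hwall₁ hwall₂ hcons hodd
    obtain ⟨c, v, hc, hv, hmatch⟩ :=
      hR a h s X hab hs hud hgsc' hglob ε L (((m₁ : ℝ) + m₂) * h / 2) hε
    obtain ⟨n, y, z, hy, hz, hyX, hdisj, hlt'⟩ := hS c v hc hv hmatch
    exact absurd (hgsc' n y z hy hz hyX hdisj) (not_le.mpr hlt')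

/-- The crux BY NAME from the three registered stubs (this line also certifies that `LowStrainWindows`,
`EvenGapSurgery`, `OddGapSurgery` are definitionally the inlined stub signatures). -/
theorem twinLoopLemma_of_stubs :
    Summit.AtomisticToContinuum.Crystallization.Theses.GscTwinLoopSurgery.TwinLoopLemma :=
  TwinLoopLemma_of stub_lowStrainWindows stub_evenGapSurgery stub_oddGapSurgery

end Composition

end Birth

end Summit.AtomisticToContinuum.Crystallization.Cruxes.TwinLoopLemma

end
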